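import Summits.MatrixMultiplication.MatrixMultiplication.Theorems.AbelianSTPPCensusShapeCertVQDefsE

/-!
# Abelian STPP census — PATH SEGMENTS of the budgeted vQ checker `ShapeCertVQ.checkQE` (definitions)

Cell mm-stpp, rung F-M1; successor kernel item VQ-CERT (T_E beyond 337 under vQ := vP ∧ E3⁺) in support of the closed crux item
stmt-MatrixMultiplication-19191; seat mm-stpp-vp-p2 (gen 1).

From order `416` on, single ROOT candidates of `checkQE M` (the `(6,6,7)`-rooted subtrees, whose one-member prefix is in the saturated
E3⁺ regime where the continuation budget is silent) exceed the gate's per-declaration kernel budget (≈ 10⁴ candidate visits of the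
budgeted search), so an order has to be split BELOW the root as well.  A PATH `[k_d, …, k_1]` (last step first) names the node reached
from the root by taking candidate `k_1` of the root's pool, then candidate `k_2` of that node's pool, …; `pathNode` computes its prefix
and pool; `pathSegQE M path i n` is the node-level decision of `dfsQE` at that node followed by the walk of the candidates `i … i+n−1` of
its pool (each with its full continuation, searched by `dfsQE` with the node's fuel), i.e. a kernel-evaluable PIECE of `checkQE M`.
`…ShapeCertVQSearchP` proves how pieces assemble: consecutive segments of a node give the node (`pathOK_of_segs`), a node gives the
one-candidate segment of its parent (`pathSeg_single_of_child`), the root node is `checkQE` (`checkQE_of_pathOK_nil`).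
WHAT THIS IS NOT: no statement about STPP families or `ω`; bookkeeping for splitting kernel evaluations.
-/

set_option linter.dupNamespace false -- `MatrixMultiplication.MatrixMultiplication` (summit = problem, D-0017)
set_option autoImplicit false

namespace Summit.MatrixMultiplication.MatrixMultiplication.Theorems.ShapeCertVQ

open ShapeCert ShapeCertVP

/-- Walk segment at an arbitrary node: `loopQ` limited to `n` steps (`true` when the steps are exhausted), closing with `cl` if the list
ends first. -/
def segLoopQ (M : ℕ) (rec : List Sh → List Sh → Bool) (fam : List Sh) (A : Agg) (ra rb rc vl g0 q : ℕ) (sel : B8 → ℕ)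
    (mdk lb1 : ℕ) (cl : Bool) : ℕ → List Sh → Bool
  | 0, _ => true
  | _ + 1, [] => cl
  | n + 1, t :: rest =>
    if t.lev < lb1 then true
    else if ra < t.wA ∨ rb < t.wB ∨ rc < t.wC ∨ vl < t.V then segLoopQ M rec fam A ra rb rc vl g0 q sel mdk lb1 cl n rest
    else stepQ M rec t A fam g0 q sel mdk rest && segLoopQ M rec fam A ra rb rc vl g0 q sel mdk lb1 cl n rest

/-- The node of a path of candidate indices (last step first): its prefix (newest member first) and its candidate pool.  The empty
path is the root (`[]`, `candQ M`); step `k` takes candidate `k` of the current pool as the new member and continues with the pool from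
there (repetitions allowed, as in the search). -/
def pathNode (M : ℕ) : List ℕ → List Sh × List Sh
  | [] => ([], candQ M)
  | k :: ks =>
    match (pathNode M ks).2.drop k with
    | [] => ((pathNode M ks).1, [])
    | t :: rest => (t :: (pathNode M ks).1, t :: rest)

/-- The node-level decision of `dfsQE` at a prefix: `some b` if the node is decided without walking its candidates (E3⁺ kill,
beating prefix, dead prefix, exhausted or closing Grynkiewicz budget), `none` if the walk is needed. -/
def nodeDecQE (M : ℕ) (fam : List Sh) : Option Bool :=
  (aggOf M fam).force fun A =>
    if killE M A fam then some true
    else if M * D < A.gs then some false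
    else if A.dead M then some true
    else
      let Bs := budsOf M A fam
      if Bs.tailEmpty then some (decide (A.gs ≤ M * D))
      else
        let S := gnodeQ (headLevQ fam) Bs
        seqN S.bud fun gB => seqN S.idx fun gi =>
          if S.ok && decide (A.gs * K + gB * (tabGQ (headLevQ fam)).get gi ≤ M * D * K) then some true
          else none

/-- The walk of `dfsQE` at a prefix over a candidate list, with the continuation `rec`, limited to `n` steps (the node's constants
recomputed exactly as in `dfsQE`). -/
def nodeWalkQE (M : ℕ) (rec : List Sh → List Sh → Bool) (fam : List Sh) (n : ℕ) (L : List Sh) : Bool :=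
  (aggOf M fam).force fun A =>
    let Bs := budsOf M A fam
    let S := gnodeQ (headLevQ fam) Bs
    seqN S.bud fun gB => seqN S.idx fun gi =>
    seqN (A.ra M) fun ra => seqN (A.rb M) fun rb => seqN (A.rc M) fun rc => seqN (A.vl M) fun vl =>
    seqN (A.gs * K) fun g0 => seqN (qEOf M A fam (A.q0 M)) fun q => seqN (A.kOf M) fun k =>
    seqN (M * D * K) fun mdk =>
    seqN (breakLevQ g0 q (selOf k) mdk S.ok gB gi) fun lb1 =>
      let cl := fam.isEmpty || decide (g0 + selOf k (tabRQ loLev) * q ≤ mdk) || clAnyQ Bs g0 mdk loLev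
      segLoopQ M rec fam A ra rb rc vl g0 q (selOf k) mdk lb1 cl n L

/-- Path segment: at the node of `path` (depth `d = path.length`, continuation `dfsQE M (M + 1 − d)` as in `checkQE`), the
node-level decision of `dfsQE`, else the walk of the pool's candidates `i … i + n − 1`. -/
def pathSegQE (M : ℕ) (path : List ℕ) (i n : ℕ) : Bool :=
  match nodeDecQE M (pathNode M path).1 with
  | some b => b
  | none => nodeWalkQE M (dfsQE M (M + 1 - path.length)) (pathNode M path).1 n (((pathNode M path).2).drop i)

/-- What the pieces of a node assemble to: the budgeted search accepts the node of `path` (with the fuel of `checkQE`). [bookkeeping] -/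
def PathOK (M : ℕ) (path : List ℕ) : Prop :=
  dfsQE M (M + 2 - path.length) (pathNode M path).1 (pathNode M path).2 = true

end Summit.MatrixMultiplication.MatrixMultiplication.Theorems.ShapeCertVQ
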